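import Summits.ResolutionOfSingularities.ResolutionOfSingularities.Theorems.PurelyInseparableDim4ResConeFourWeights
import Summits.ResolutionOfSingularities.ResolutionOfSingularities.Theorems.PurelyInseparableDim4ResConeHeavyEntryFrame
import Summits.ResolutionOfSingularities.ResolutionOfSingularities.Theorems.PurelyInseparableDim4ResConePowerChainTilt
import HarnessLib
import HarnessLib.Audit.Tags

/-!
# Purely inseparable four-folds — the WEIGHT AUTOMATON of a constant-shade tail for EVERY prime `p` and
# EVERY shade `d`: the floor automaton (heavy class absorbing, LIGHT-or-eventually-HEAVY dichotomy, floor keeps,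
# ceiling founds a lone letter, descending staircase), the sharp ceiling, and the lower-band VISIT DOCK
# (cell `res-dim4-pi`, K2(p) lane, brick «W_gen» — all-shade core only)

[OURS · counted 0 · cell `res-dim4-pi` · K2(p) lane (holder res-dim4-p-12 g4, ruling (4) of 2026-08-29 08:19Z: «W_gen
GO for the all-shade core only») · seat res-dim4-p-3 g5.]  Nothing here proves K2(p) = `RidgeBudget.NoAboveFloorTrap p p`
for any `p`, `NoIsolatedTrap p p`, the Cossart–Jannsen–Saito theorem or resolution of singularities in dimension ≥ 4 /
characteristic `p` — NOT proved.  AI kernel work, weaker than expert review.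

The holder's W (`…ThreeWeights`, `(5,3)`), W₄ (`…FourWeights`, `(5,4)`) and res-dim4-p-5 g5's `…PrimeWeights`
(`(p, p−1)`) run the weights-only automaton of a witnessed isolated above-floor `Step0` chain of constant shade; the
chain-to-automaton LAWS for every `(p, d)` are res-dim4-p-9 g5's `ResCone.tail_weights_laws` (`…HeavyEntryFrame` §3:
`o_k = |r_k| + d`, law `r_{k+1} = (r_k|_{b_k = 0}).update (j k) (|r_k| + d − p)`, `b k (j k) = 0`, band
`p < |r_k| + d < 2p`, pair bound `r_k i + r_k i' ≤ p − 2`), imported BY NAME.  This file adds the part of the automaton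
that holds for EVERY prime `p` and EVERY shade `d` (pure `(r, j, b)` numerics, no algebra):
* §1 CORE over `r : ℕ → Fin 4 →₀ ℕ` in that law's syntax with FLOOR `p < |r_k| + d`: `two_le_succ_of_floor` /
  `two_le_from_of_floor` (the heavy class «some weight `≥ 2`» is ABSORBING — floor only, no pair bound),
  **`weights_dichotomy_of_floor`** (EITHER every `k ≥ k₀` is LIGHT: all weights `≤ 1` and `|r_k| + d = p + 1`, OR from some
  `k₁ ≥ k₀` on every state has a letter of weight `≥ 2`), `eventually_heavy_of_floor` (shades `d ≤ p − 4` are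
  eventually HEAVY: a light state needs `p + 1 − d ≤ 4` letters), `keep_heavy_of_floor` (a floor state keeps every heavy letter,
  the newborn weighs `1`), `apply_le_of_pair`, `kept_add_newborn_le`, `succ_eq_single_of_ceiling` (a CEILING state
  `|r_k| + d + 2 = 2p` founds the LONE newborn `(p − 2)`), **`lone_hit_of_two_mul`** (a LONE letter of weight `w` with
  `2p < 2w + d + 2` is hit and the child is the lone newborn `(w + d − p)` — the descending staircase
  `(p−2) → (2p−4−d) → …` below a ceiling state).
* §2 DRESS `(p : ℕ) [Fact p.Prime] [CharP K p]`, any `d`, over `tail_weights_laws`: **`shadeWeights_dichotomy`**,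
  `shadeWeights_heavy_from`, `shadeWeights_eventually_heavy` (`d + 4 ≤ p`), `shadeWeights_keep_heavy_of_floor`, **`shadeWeights_ceiling`** (the SHARP band
  `|r_k| + d + 2 ≤ 2p`, from `chain_shade_nat'`), `shadeWeights_succ_eq_single_of_ceiling`, `shadeWeights_lone_hit`, and
  the FT-free VISIT DOCK **`no_tail_of_lower_band_budget`**: boundedly many `k ≥ k₁` with `|r_k| + d < 3p/2` is impossible
  (`BandLayers.no_isolated_chain_eventually_upper`).
W / W₄ / `…PrimeWeights` are instances or the `d = p − 1` dress (not re-derived; no `(p, p−1)` statement here).  NOT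
claimed: the heavy-branch normal form beyond «some weight `≥ 2`» for general `p` — at `(7,6)` it is res-dim4-idea-4's
zoo `(2,2)/(3)/(3,2)/(4)/(1,3)`; «light pair + D∞-type» exhausts slice C(p, p−1) ONLY at `p = 5` (holder's caveat of
record); §1 gives only the p-free skeleton those classes live in.  Rung-1 generic material of a FUTURE K2(7) campaign —
NOT K2(7), NOT a claim on slice B(7) or on any `(7, d)` tail.

[cite: CossartJannsenSaito2020, Thm. 3.14, Lemma 13.2] [cite: HauserPerlega2019PRIMS, §2 (transform D′ of D)]
bears_on: LADDER-RESOLUTION:D157-DOOR2 (res-dim4-pi · K2(p) · weights automaton, every prime, every shade).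
Supports stmt-ResolutionOfSingularities-16155 (helper).
-/

set_option linter.dupNamespace false -- mandated namespace of this single-conjunct summit

noncomputable section

namespace Summit.ResolutionOfSingularities.ResolutionOfSingularities.Theorems.PIDim4

namespace ResCone

open MvPolynomial Finset
open Literature.AlgebraicGeometry.Resolution
open Literature.AlgebraicGeometry.Resolution.CentreBlowup
open Literature.AlgebraicGeometry.Resolution.Hauser2010
open Literature.AlgebraicGeometry.Resolution.HauserPerlega2019

variable {K : Type} [Field K]

/-! ## 1. Core numerics for every `(p, d)`: law `|r_k| + d − p`, floor `p < |r_k| + d`, pair bound `p − 2` -/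

section Core

variable [DecidableEq K] {r : ℕ → Fin 4 →₀ ℕ} {j : ℕ → Fin 4} {b : ℕ → Fin 4 → K} {k₀ p d : ℕ}

/-- **The heavy class is absorbing** (every `(p, d)`, floor only): a letter of weight `≥ 2` at `k ≥ k₀` is followed by
one at `k + 1` — strictly above the floor the newborn letter weighs `≥ 2`; at the floor the heavy letter is kept, since
hitting it would drop the child below the floor. [OURS] [folklore] -/
theorem two_le_succ_of_floor
    (hlaw : ∀ k, k₀ ≤ k → r (k + 1) = ((r k).filter (fun i => b k i = 0)).update (j k) ((r k).degree + d - p))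
    (hbj : ∀ k, b k (j k) = 0) (hfloor : ∀ k, k₀ ≤ k → p < (r k).degree + d) {k : ℕ} (hk : k₀ ≤ k)
    (hheavy : ∃ W, 2 ≤ r k W) : ∃ W, 2 ≤ r (k + 1) W := by
  obtain ⟨W, hW⟩ := hheavy
  rcases Nat.lt_or_ge ((r k).degree + d) (p + 2) with hlt | hge
  · -- floor state: `W` is kept
    refine ⟨W, ?_⟩
    have hkeep : ¬ (j k = W ∨ b k W ≠ 0) := fun hhit => by
      have h := degree_succ_add_le_of_hit' (hlaw k hk) (hbj k) hhit
      have h1 := hfloor (k + 1) (by omega)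
      omega
    push Not at hkeep
    rw [apply_succ_kept_of_update (hlaw k hk) hkeep.1 hkeep.2]
    exact hW
  · exact ⟨j k, by rw [apply_succ_self_of_update (hlaw k hk)]; omega⟩

/-- Heaviness for ever from the first heavy state (every `(p, d)`, floor only). [OURS] [folklore] -/
theorem two_le_from_of_floor
    (hlaw : ∀ k, k₀ ≤ k → r (k + 1) = ((r k).filter (fun i => b k i = 0)).update (j k) ((r k).degree + d - p))
    (hbj : ∀ k, b k (j k) = 0) (hfloor : ∀ k, k₀ ≤ k → p < (r k).degree + d) {k₁ : ℕ} (hk₁ : k₀ ≤ k₁)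
    (hheavy : ∃ W, 2 ≤ r k₁ W) : ∀ k, k₁ ≤ k → ∃ W, 2 ≤ r k W := by
  intro k hk
  obtain ⟨n, rfl⟩ := Nat.exists_eq_add_of_le hk
  induction n with
  | zero => simpa using hheavy
  | succ n ih =>
    have h := two_le_succ_of_floor hlaw hbj hfloor (k := k₁ + n) (by omega) (ih (Nat.le_add_right _ _))
    simpa only [Nat.add_succ] using h

/-- **THE WEIGHTS DICHOTOMY for every `(p, d)`** (core form, floor only): EITHER every state `k ≥ k₀` is LIGHT (all
weights `≤ 1` and `|r_k| + d = p + 1`, i.e. AT the floor), OR from some `k₁ ≥ k₀` on every state has a letter of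
weight `≥ 2`.  (A state with all weights `≤ 1` strictly above the floor founds a newborn of weight `≥ 2`.)
[OURS] [folklore] -/
theorem weights_dichotomy_of_floor
    (hlaw : ∀ k, k₀ ≤ k → r (k + 1) = ((r k).filter (fun i => b k i = 0)).update (j k) ((r k).degree + d - p))
    (hbj : ∀ k, b k (j k) = 0) (hfloor : ∀ k, k₀ ≤ k → p < (r k).degree + d) :
    (∀ k, k₀ ≤ k → (∀ i, r k i ≤ 1) ∧ (r k).degree + d = p + 1) ∨
    (∃ k₁, k₀ ≤ k₁ ∧ ∀ k, k₁ ≤ k → ∃ W, 2 ≤ r k W) := by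
  by_cases hall : ∀ k, k₀ ≤ k → (∀ i, r k i ≤ 1) ∧ (r k).degree + d = p + 1
  · exact Or.inl hall
  · right
    push Not at hall
    obtain ⟨k, hk, hbad⟩ := hall
    by_cases hh : ∃ W, 2 ≤ r k W
    · exact ⟨k, hk, two_le_from_of_floor hlaw hbj hfloor hk hh⟩
    · push Not at hh
      have h1 : ∀ i, r k i ≤ 1 := fun i => by have := hh i; omega
      have hup : p + 2 ≤ (r k).degree + d := by
        have := hfloor k hk; have := hbad h1; omega
      refine ⟨k + 1, by omega, two_le_from_of_floor hlaw hbj hfloor (k₁ := k + 1) (by omega) ⟨j k, ?_⟩⟩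
      rw [apply_succ_self_of_update (hlaw k hk)]
      omega

/-- Four letters of weight `≤ 1` weigh `≤ 4` in total. [folklore] -/
theorem degree_le_four_of_forall_le_one {f : Fin 4 →₀ ℕ} (h : ∀ i, f i ≤ 1) : f.degree ≤ 4 := by
  rw [Finsupp.degree_eq_sum, Fin.sum_univ_four]
  have := h 0; have := h 1; have := h 2; have := h 3
  omega

/-- **LOW SHADES ARE EVENTUALLY HEAVY** (every `(p, d)` with `d + 4 ≤ p`, floor only): a LIGHT state needs
`|r_k| = p + 1 − d ≤ 4` letters of weight `1`, impossible for `d ≤ p − 4`; so from some `k₁ ≥ k₀` on every state has a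
letter of weight `≥ 2`. [OURS] [folklore] -/
theorem eventually_heavy_of_floor
    (hlaw : ∀ k, k₀ ≤ k → r (k + 1) = ((r k).filter (fun i => b k i = 0)).update (j k) ((r k).degree + d - p))
    (hbj : ∀ k, b k (j k) = 0) (hfloor : ∀ k, k₀ ≤ k → p < (r k).degree + d) (h4 : d + 4 ≤ p) :
    ∃ k₁, k₀ ≤ k₁ ∧ ∀ k, k₁ ≤ k → ∃ W, 2 ≤ r k W := by
  rcases weights_dichotomy_of_floor hlaw hbj hfloor with hlight | hheavy
  · exfalso
    obtain ⟨h1, hdeg⟩ := hlight k₀ le_rfl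
    have := degree_le_four_of_forall_le_one h1
    omega
  · exact hheavy

/-- **A floor state keeps every heavy letter** (every `(p, d)`): at `|r_k| + d = p + 1` a letter `W` of weight `≥ 2` is
neither charted nor translated, keeps its weight, and the newborn letter weighs `1`. [OURS] [folklore] -/
theorem keep_heavy_of_floor
    (hlaw : ∀ k, k₀ ≤ k → r (k + 1) = ((r k).filter (fun i => b k i = 0)).update (j k) ((r k).degree + d - p))
    (hbj : ∀ k, b k (j k) = 0) (hfloor : ∀ k, k₀ ≤ k → p < (r k).degree + d) {k : ℕ} (hk : k₀ ≤ k)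
    (hdeg : (r k).degree + d = p + 1) {W : Fin 4} (hW : 2 ≤ r k W) :
    j k ≠ W ∧ b k W = 0 ∧ r (k + 1) W = r k W ∧ r (k + 1) (j k) = 1 := by
  have hnot : ¬ (j k = W ∨ b k W ≠ 0) := fun hhit => by
    have h := degree_succ_add_le_of_hit' (hlaw k hk) (hbj k) hhit
    have := hfloor (k + 1) (by omega)
    omega
  push Not at hnot
  refine ⟨hnot.1, hnot.2, apply_succ_kept_of_update (hlaw k hk) hnot.1 hnot.2, ?_⟩
  rw [apply_succ_self_of_update (hlaw k hk)]
  omega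

/-- In the LIGHT branch every newborn letter weighs `1`. [OURS] [folklore] -/
theorem apply_succ_self_of_light
    (hlaw : ∀ k, k₀ ≤ k → r (k + 1) = ((r k).filter (fun i => b k i = 0)).update (j k) ((r k).degree + d - p))
    {k : ℕ} (hk : k₀ ≤ k) (hdeg : (r k).degree + d = p + 1) : r (k + 1) (j k) = 1 := by
  rw [apply_succ_self_of_update (hlaw k hk)]
  omega

/-- Every weight is `≤ p − 2` under the pair bound (compare with any other letter). [folklore] -/
theorem apply_le_of_pair (hpair : ∀ k, k₀ ≤ k → ∀ i i', i ≠ i' → r k i + r k i' ≤ p - 2) {k : ℕ} (hk : k₀ ≤ k)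
    (i : Fin 4) : r k i ≤ p - 2 := by
  obtain ⟨i', hi'⟩ : ∃ i' : Fin 4, i' ≠ i := exists_ne i
  have := hpair k hk i i' (Ne.symm hi')
  omega

/-- A kept letter is bounded against the newborn one: if `W ≠ j k` is not translated at step `k ≥ k₀`, then
`r_k W + (|r_k| + d − p) ≤ p − 2` (pair bound at `k + 1`). [OURS] [folklore] -/
theorem kept_add_newborn_le
    (hlaw : ∀ k, k₀ ≤ k → r (k + 1) = ((r k).filter (fun i => b k i = 0)).update (j k) ((r k).degree + d - p))
    (hpair : ∀ k, k₀ ≤ k → ∀ i i', i ≠ i' → r k i + r k i' ≤ p - 2) {k : ℕ} (hk : k₀ ≤ k) {W : Fin 4}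
    (hjW : j k ≠ W) (hbW : b k W = 0) : r k W + ((r k).degree + d - p) ≤ p - 2 := by
  have h := hpair (k + 1) (by omega) W (j k) (Ne.symm hjW)
  rw [apply_succ_kept_of_update (hlaw k hk) hjW hbW, apply_succ_self_of_update (hlaw k hk)] at h
  exact h

/-- **A CEILING state founds a lone heavy letter** (every `(p, d)`, pair bound): at `|r_k| + d + 2 = 2p` the newborn
letter weighs `p − 2`, so every other letter is absent at `k + 1`: `r_{k+1} = (p − 2)·e_{j k}`. [OURS] [folklore] -/
theorem succ_eq_single_of_ceiling
    (hlaw : ∀ k, k₀ ≤ k → r (k + 1) = ((r k).filter (fun i => b k i = 0)).update (j k) ((r k).degree + d - p))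
    (hpair : ∀ k, k₀ ≤ k → ∀ i i', i ≠ i' → r k i + r k i' ≤ p - 2) {k : ℕ} (hk : k₀ ≤ k)
    (hceil : (r k).degree + d + 2 = 2 * p) :
    r (k + 1) (j k) = p - 2 ∧ ∀ i, i ≠ j k → r (k + 1) i = 0 := by
  have hnew : r (k + 1) (j k) = p - 2 := by
    rw [apply_succ_self_of_update (hlaw k hk)]
    omega
  refine ⟨hnew, fun i hi => ?_⟩
  have := hpair (k + 1) (by omega) (j k) i (Ne.symm hi)
  omega

/-- **THE DESCENDING STAIRCASE** (every `(p, d)`, floor + pair bound): a LONE boundary letter `W` of weight `w` with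
`2p < 2w + d + 2` cannot be kept (it and the newborn `w + d − p` would break the pair bound), so it is charted or
translated and the child is the LONE newborn letter of weight `w + d − p`.  Below a ceiling state this gives
`(p − 2) → (2p − 4 − d) → …` as long as the inequality persists. [OURS] [folklore] -/
theorem lone_hit_of_two_mul
    (hlaw : ∀ k, k₀ ≤ k → r (k + 1) = ((r k).filter (fun i => b k i = 0)).update (j k) ((r k).degree + d - p))
    (hfloor : ∀ k, k₀ ≤ k → p < (r k).degree + d)
    (hpair : ∀ k, k₀ ≤ k → ∀ i i', i ≠ i' → r k i + r k i' ≤ p - 2) {k : ℕ} (hk : k₀ ≤ k) {W : Fin 4}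
    (hlone : ∀ i, i ≠ W → r k i = 0) (hgt : 2 * p < 2 * r k W + d + 2) :
    (j k = W ∨ b k W ≠ 0) ∧ r (k + 1) (j k) = r k W + d - p ∧ ∀ i, i ≠ j k → r (k + 1) i = 0 := by
  classical
  have hdeg : (r k).degree = r k W := by
    rw [Finsupp.degree_eq_sum, Fintype.sum_eq_single W (fun i hi => hlone i hi)]
  have hhit : j k = W ∨ b k W ≠ 0 := by
    by_contra h
    push Not at h
    have hkept := kept_add_newborn_le hlaw hpair hk h.1 h.2
    have hfl := hfloor k hk
    rw [hdeg] at hkept hfl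
    have hsub : r k W + d - p + p = r k W + d := Nat.sub_add_cancel hfl.le
    omega
  refine ⟨hhit, by rw [apply_succ_self_of_update (hlaw k hk), hdeg], fun i hi => ?_⟩
  rw [law_apply_of_update (hlaw k hk) i, if_neg hi]
  split_ifs with hbi
  · by_cases hiW : i = W
    · subst hiW
      rcases hhit with h | h
      · exact absurd h.symm hi
      · exact absurd hbi h
    · exact hlone i hiW
  · rfl

end Core

/-! ## 2. The dress for every prime `p` and every shade `d`, over `tail_weights_laws` -/

section Chain

variable [DecidableEq K]

/-- **THE WEIGHTS DICHOTOMY, every prime `p`, every shade `d`** (no `e_G`, no lightness hypothesis): along a witnessed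
isolated above-floor `Step0 p` chain with `x^{r₀} ∣ F₀` and constant shade `d` from `k₀`, EITHER every `k ≥ k₀` is LIGHT
(all weights `≤ 1` and `|r_k| + d = p + 1`, i.e. `o_k = p + 1`), OR from some `k₁ ≥ k₀` on every state has a letter of
weight `≥ 2`. [OURS] [cite: CossartJannsenSaito2020, Thm. 3.14] -/
theorem shadeWeights_dichotomy (p : ℕ) [Fact p.Prime] {c : ℕ → State K} {j : ℕ → Fin 4} {b : ℕ → Fin 4 → K}
    (hc : ∀ k, IsIsolated p (c k).F ∧ Step0 p (c k) (c (k + 1))) (hw : FreeTail.IsWitnessedChain p c j b)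
    (hr0 : ∀ e ∈ (c 0).F.support, (c 0).r ≤ e) (hfloor : ∀ k, ordZero (c k).F ≠ p) {k₀ d : ℕ}
    (hshade : ∀ k, k₀ ≤ k → (c k).shade = (d : ℕ∞)) :
    (∀ k, k₀ ≤ k → (∀ i, (c k).r i ≤ 1) ∧ (c k).r.degree + d = p + 1) ∨
    (∃ k₁, k₀ ≤ k₁ ∧ ∀ k, k₁ ≤ k → ∃ W, 2 ≤ (c k).r W) := by
  obtain ⟨-, hlaw, hbj, hband, -⟩ := tail_weights_laws hc hw hr0 hfloor hshade
  exact weights_dichotomy_of_floor hlaw hbj fun k hk => (hband k hk).1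

/-- **Heavy for ever from the first heavy state**, every prime `p`, every shade `d`. [OURS] [folklore] -/
theorem shadeWeights_heavy_from (p : ℕ) [Fact p.Prime] {c : ℕ → State K} {j : ℕ → Fin 4} {b : ℕ → Fin 4 → K}
    (hc : ∀ k, IsIsolated p (c k).F ∧ Step0 p (c k) (c (k + 1))) (hw : FreeTail.IsWitnessedChain p c j b)
    (hr0 : ∀ e ∈ (c 0).F.support, (c 0).r ≤ e) (hfloor : ∀ k, ordZero (c k).F ≠ p) {k₀ d : ℕ}
    (hshade : ∀ k, k₀ ≤ k → (c k).shade = (d : ℕ∞)) {k₁ : ℕ} (hk₁ : k₀ ≤ k₁) (hheavy : ∃ W, 2 ≤ (c k₁).r W) :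
    ∀ k, k₁ ≤ k → ∃ W, 2 ≤ (c k).r W := by
  obtain ⟨-, hlaw, hbj, hband, -⟩ := tail_weights_laws hc hw hr0 hfloor hshade
  exact two_le_from_of_floor hlaw hbj (fun k hk => (hband k hk).1) hk₁ hheavy

/-- **LOW SHADES ARE EVENTUALLY HEAVY on the chain** (every prime `p`, every shade `d ≤ p − 4`): from some `k₁ ≥ k₀` on
every state has a boundary letter of weight `≥ 2` (at `p = 7`: every constant-shade-`d ≤ 3` tail). [OURS] [folklore] -/
theorem shadeWeights_eventually_heavy (p : ℕ) [Fact p.Prime] {c : ℕ → State K} {j : ℕ → Fin 4}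
    {b : ℕ → Fin 4 → K} (hc : ∀ k, IsIsolated p (c k).F ∧ Step0 p (c k) (c (k + 1)))
    (hw : FreeTail.IsWitnessedChain p c j b) (hr0 : ∀ e ∈ (c 0).F.support, (c 0).r ≤ e)
    (hfloor : ∀ k, ordZero (c k).F ≠ p) {k₀ d : ℕ} (hshade : ∀ k, k₀ ≤ k → (c k).shade = (d : ℕ∞))
    (h4 : d + 4 ≤ p) : ∃ k₁, k₀ ≤ k₁ ∧ ∀ k, k₁ ≤ k → ∃ W, 2 ≤ (c k).r W := by
  obtain ⟨-, hlaw, hbj, hband, -⟩ := tail_weights_laws hc hw hr0 hfloor hshade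
  exact eventually_heavy_of_floor hlaw hbj (fun k hk => (hband k hk).1) h4

/-- **A floor state keeps every heavy letter**, every prime `p`, every shade `d`: at `o_k = p + 1` a letter of weight
`≥ 2` is neither charted nor translated and keeps its weight; the newborn letter weighs `1`. [OURS] [folklore] -/
theorem shadeWeights_keep_heavy_of_floor (p : ℕ) [Fact p.Prime] {c : ℕ → State K} {j : ℕ → Fin 4}
    {b : ℕ → Fin 4 → K} (hc : ∀ k, IsIsolated p (c k).F ∧ Step0 p (c k) (c (k + 1)))
    (hw : FreeTail.IsWitnessedChain p c j b) (hr0 : ∀ e ∈ (c 0).F.support, (c 0).r ≤ e)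
    (hfloor : ∀ k, ordZero (c k).F ≠ p) {k₀ d : ℕ} (hshade : ∀ k, k₀ ≤ k → (c k).shade = (d : ℕ∞)) {k : ℕ}
    (hk : k₀ ≤ k) (hdeg : (c k).r.degree + d = p + 1) {W : Fin 4} (hW : 2 ≤ (c k).r W) :
    j k ≠ W ∧ b k W = 0 ∧ (c (k + 1)).r W = (c k).r W ∧ (c (k + 1)).r (j k) = 1 := by
  obtain ⟨-, hlaw, hbj, hband, -⟩ := tail_weights_laws hc hw hr0 hfloor hshade
  exact keep_heavy_of_floor hlaw hbj (fun k hk => (hband k hk).1) hk hdeg hW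

/-- **THE SHARP CEILING**, every prime `p`, every shade `d`: `|r_k| + d + 2 ≤ 2p` for `k ≥ k₀` (the order `2p − 1` does not
occur on an isolated above-floor chain: `chain_shade_nat'`). [OURS · bookkeeping] [folklore] -/
theorem shadeWeights_ceiling (p : ℕ) [Fact p.Prime] [CharP K p] {c : ℕ → State K} {j : ℕ → Fin 4}
    {b : ℕ → Fin 4 → K} (hc : ∀ k, IsIsolated p (c k).F ∧ Step0 p (c k) (c (k + 1)))
    (hw : FreeTail.IsWitnessedChain p c j b) (hr0 : ∀ e ∈ (c 0).F.support, (c 0).r ≤ e)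
    (hfloor : ∀ k, ordZero (c k).F ≠ p) {k₀ d : ℕ} (hshade : ∀ k, k₀ ≤ k → (c k).shade = (d : ℕ∞)) {k : ℕ}
    (hk : k₀ ≤ k) : (c k).r.degree + d + 2 ≤ 2 * p := by
  obtain ⟨hord, -, -, -, -⟩ := tail_weights_laws hc hw hr0 hfloor hshade
  obtain ⟨o, ho, -, ho2, -⟩ := chain_shade_nat' p hc hfloor hshade hk
  rw [hord k hk] at ho
  have hoe : (c k).r.degree + d = o := by exact_mod_cast ho
  omega

/-- **A ceiling state founds the lone newborn `(p − 2)`**, every prime `p`, every shade `d`. [OURS] [folklore] -/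
theorem shadeWeights_succ_eq_single_of_ceiling (p : ℕ) [Fact p.Prime] {c : ℕ → State K} {j : ℕ → Fin 4}
    {b : ℕ → Fin 4 → K} (hc : ∀ k, IsIsolated p (c k).F ∧ Step0 p (c k) (c (k + 1)))
    (hw : FreeTail.IsWitnessedChain p c j b) (hr0 : ∀ e ∈ (c 0).F.support, (c 0).r ≤ e)
    (hfloor : ∀ k, ordZero (c k).F ≠ p) {k₀ d : ℕ} (hshade : ∀ k, k₀ ≤ k → (c k).shade = (d : ℕ∞)) {k : ℕ}
    (hk : k₀ ≤ k) (hceil : (c k).r.degree + d + 2 = 2 * p) :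
    (c (k + 1)).r (j k) = p - 2 ∧ ∀ i, i ≠ j k → (c (k + 1)).r i = 0 := by
  obtain ⟨-, hlaw, -, -, hpair⟩ := tail_weights_laws hc hw hr0 hfloor hshade
  exact succ_eq_single_of_ceiling hlaw (fun k _ => hpair k) hk hceil

/-- **THE DESCENDING STAIRCASE on the chain**, every prime `p`, every shade `d`: a lone boundary letter of weight `w`
with `2p < 2w + d + 2` is hit and the child is the lone newborn letter of weight `w + d − p`. [OURS] [folklore] -/
theorem shadeWeights_lone_hit (p : ℕ) [Fact p.Prime] {c : ℕ → State K} {j : ℕ → Fin 4} {b : ℕ → Fin 4 → K}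
    (hc : ∀ k, IsIsolated p (c k).F ∧ Step0 p (c k) (c (k + 1))) (hw : FreeTail.IsWitnessedChain p c j b)
    (hr0 : ∀ e ∈ (c 0).F.support, (c 0).r ≤ e) (hfloor : ∀ k, ordZero (c k).F ≠ p) {k₀ d : ℕ}
    (hshade : ∀ k, k₀ ≤ k → (c k).shade = (d : ℕ∞)) {k : ℕ} (hk : k₀ ≤ k) {W : Fin 4}
    (hlone : ∀ i, i ≠ W → (c k).r i = 0) (hgt : 2 * p < 2 * (c k).r W + d + 2) :
    (j k = W ∨ b k W ≠ 0) ∧ (c (k + 1)).r (j k) = (c k).r W + d - p ∧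
      ∀ i, i ≠ j k → (c (k + 1)).r i = 0 := by
  obtain ⟨-, hlaw, -, hband, hpair⟩ := tail_weights_laws hc hw hr0 hfloor hshade
  exact lone_hit_of_two_mul hlaw (fun k hk => (hband k hk).1) (fun k _ => hpair k) hk hlone hgt

/-- **THE LOWER-BAND VISIT DOCK, every prime `p`, every shade `d`** (FT-free): along a witnessed isolated above-floor
`Step0 p` chain with `x^{r₀} ∣ F₀` and constant shade `d` from `k₀`, the indices `k ≥ k₁` with `o_k = |r_k| + d < 3p/2`
cannot be bounded in number — else `o_k ≥ 3p/2` from some index on, excluded by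
`BandLayers.no_isolated_chain_eventually_upper`.  (W's `no_three_tail_of_degree_three_budget` and W₄'s
`no_four_tail_of_degree_two_budget` are the instances `(5,3)`, `(5,4)`.) [OURS] [cite: CossartJannsenSaito2020, Thm. 3.14] -/
theorem no_tail_of_lower_band_budget (p : ℕ) [Fact p.Prime] [CharP K p] {c : ℕ → State K} {j : ℕ → Fin 4}
    {b : ℕ → Fin 4 → K} (hc : ∀ k, IsIsolated p (c k).F ∧ Step0 p (c k) (c (k + 1)))
    (hw : FreeTail.IsWitnessedChain p c j b) (hr0 : ∀ e ∈ (c 0).F.support, (c 0).r ≤ e)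
    (hfloor : ∀ k, ordZero (c k).F ≠ p) {k₀ d : ℕ} (hshade : ∀ k, k₀ ≤ k → (c k).shade = (d : ℕ∞)) {k₁ : ℕ}
    (hk₁ : k₀ ≤ k₁) {B : ℕ}
    (hbudget : ∀ n, ((Finset.range n).filter (fun i => (c (k₁ + i)).r.degree + d < 3 * p / 2)).card ≤ B) :
    False := by
  classical
  obtain ⟨hord, -, -, -, -⟩ := tail_weights_laws hc hw hr0 hfloor hshade
  have hev : ∃ k₂, k₁ ≤ k₂ ∧ ∀ k, k₂ ≤ k → ¬ (c k).r.degree + d < 3 * p / 2 := by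
    by_contra hno
    push Not at hno
    have hgrow : ∀ m, ∃ n, m ≤ ((Finset.range n).filter (fun i => (c (k₁ + i)).r.degree + d < 3 * p / 2)).card := by
      intro m
      induction m with
      | zero => exact ⟨0, Nat.zero_le _⟩
      | succ m ih =>
        obtain ⟨n, hn⟩ := ih
        obtain ⟨k, hk, h2⟩ := hno (k₁ + n) (by omega)
        refine ⟨k - k₁ + 1, ?_⟩
        have hsub : (Finset.range n).filter (fun i => (c (k₁ + i)).r.degree + d < 3 * p / 2) ⊆
            (Finset.range (k - k₁ + 1)).filter (fun i => (c (k₁ + i)).r.degree + d < 3 * p / 2) := by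
          intro i hi
          simp only [Finset.mem_filter, Finset.mem_range] at hi ⊢
          exact ⟨by omega, hi.2⟩
        have hmem : k - k₁ ∈ (Finset.range (k - k₁ + 1)).filter
            (fun i => (c (k₁ + i)).r.degree + d < 3 * p / 2) := by
          simp only [Finset.mem_filter, Finset.mem_range]
          exact ⟨by omega, by rwa [show k₁ + (k - k₁) = k by omega]⟩
        have hnot : k - k₁ ∉ (Finset.range n).filter (fun i => (c (k₁ + i)).r.degree + d < 3 * p / 2) := by
          simp only [Finset.mem_filter, Finset.mem_range, not_and]
          intro h; omega
        have := Finset.card_lt_card ⟨hsub, fun h => hnot (h hmem)⟩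
        omega
    obtain ⟨n, hn⟩ := hgrow (B + 1)
    have := hbudget n
    omega
  obtain ⟨k₂, hk₂, hne⟩ := hev
  refine BandLayers.no_isolated_chain_eventually_upper p hc (k₀ := k₂) fun k hk => ?_
  have h3 : 3 * p / 2 ≤ (c k).r.degree + d := by have := hne k hk; omega
  rw [hord k (by omega)]
  exact_mod_cast h3

end Chain

end ResCone

end Summit.ResolutionOfSingularities.ResolutionOfSingularities.Theorems.PIDim4

end
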